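import Mathlib
import HarnessLib
import Summits.HubbardSuperconductivity.HubbardSuperconductivity.Theorems.KLProgrammePerturbedFermiCurveTwoFrameCurve
import Summits.HubbardSuperconductivity.HubbardSuperconductivity.Theorems.KLProgrammePerturbedFermiCurveHigherDerivsFrame

/-!
# Route `KLProgramme` — two TrigPolyC4v FRAMES `K, K′` of common `C²` size at a common level: the Fermi-radius towers and the curve towers
# differ by amounts LINEAR in the sizes `E_j` of `K′ − K` (orders 0–4; the one crude term `32·A₄` at order four)

Cell `gate-hubbard-kl`, seat hubbard-kl-k3c3-p3 (g3; row «implicit-function / monotonicity route»).  Frame-keyed packaging of the two-frame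
tower (`…TwoFrameBand`, `…TwoFrameBand34`, `…TwoFrameCurve`) for the (E3a-MS) recipe of record (L)+(F) (k3c3-p1 MS-DESIGN-NOTE §3,
GEN5-AUDIT-ANNEX row T-ms; gen-5 ENGINE child stmt-HubbardSuperconductivity-19918, `stub_twoLeg_step`): the frames of (F)'s chain are NOT
partial sums of `FrameOK`'s pieces (level shift, frequency split), so the statement is for an ARBITRARY pair `K, K′` with
(i) a common `C²` size `A` (`‖Dʲ frameShift‖ ≤ A`, `j ≤ 2`, `2A < Dt_min`) at a common level `ν` with window margins `[ν − A, ν + A] ⊂ [−1.1, −0.1]`,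
(ii) common order-3/4 sizes `A₃, A₄`, (iii) sup bounds `E_j` on `Dʲ(−K′.eval) − Dʲ(−K.eval)` over the closed square (`j ≤ 4`; e.g.
`E_j = 2ʲ·sup‖Dʲ frameShift (K′ − K)‖`).  Conclusions at every angle `θ`: `|v − u| ≤ W₀`, `|v′ − u′| ≤ W₁`, … in closed form (orders 0, 1
fully explicit; 2–4 incremental through the lower `W`'s and the tower bounds `R₁ … R₄`), and the curve-tower differences `dD_i` via
`norm_iteratedFDeriv_curve_sub_le_four_orders`.  `u = klFermiRadius` of `K` at level `ν`, i.e. `perturbedFermiRadius (−K.eval) ν`.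

Everything is PROVED; no definitions; nothing about the Hubbard model.  References: BGM 2006 §2.4 Lemma 2.1 (2.40)
[cite: BenfattoGiulianiMastropietro2006]; FST IV (CPAM 53 (2000) 1350) Thm 2.
-/

noncomputable section

namespace Summit.HubbardSuperconductivity.HubbardSuperconductivity.Theorems.PerturbedFermiCurve

set_option linter.dupNamespace false -- summit = problem name (single-conjunct summit), D-0017
set_option maxSynthPendingDepth 3 -- nested operator-norm instances (third/fourth Fréchet derivatives)

open Real Set
open Literature.MathematicalPhysics.QuantumLattice Literature.MathematicalPhysics.QuantumLattice.BandSectorCounting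
open Summit.HubbardSuperconductivity.HubbardSuperconductivity.Theorems.DispersionFlow
open Summit.HubbardSuperconductivity.HubbardSuperconductivity.Theorems.KLRegimeSplit

section TwoFrames

variable {a b : ℝ} (B : BandBounds a b) {K K' : TrigPolyC4v} {A : ℝ}
  (hA : ∀ p : Momentum, ∀ j ≤ 2, ‖iteratedFDeriv ℝ j (frameShift K) p‖ ≤ A)
  (hA' : ∀ p : Momentum, ∀ j ≤ 2, ‖iteratedFDeriv ℝ j (frameShift K') p‖ ≤ A) (hADt : 2 * A < B.Dtmin)
  {ν : ℝ} (hlo : a ≤ ν - A) (hhi : ν + A ≤ b)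
  {E₀ : ℝ} (hE₀ : ∀ k : Fin 2 → ℝ, (∀ i, |k i| ≤ π) → |(fun p : Fin 2 → ℝ => -K'.eval p) k - (fun p : Fin 2 → ℝ => -K.eval p) k| ≤ E₀)
include B hA hA' hADt hlo hhi hE₀

/-- **Order 0, two frames**: `|u_{K′}(θ) − u_K(θ)| ≤ E₀/(Dt_min − 2A)`. [cite: BenfattoGiulianiMastropietro2006, §2.4 Lemma 2.1] -/
theorem abs_frameRadius_sub_le (θ : ℝ) :
    |perturbedFermiRadius (fun p : Fin 2 → ℝ => -K'.eval p) ν θ - perturbedFermiRadius (fun p : Fin 2 → ℝ => -K.eval p) ν θ| ≤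
      E₀ / (B.Dtmin - 2 * A) := by
  obtain ⟨hC, hδ, hκ, -, hroot⟩ := frame_band_data B hA hlo hhi
  obtain ⟨hC', hδ', hκ', -, hroot'⟩ := frame_band_data B hA' hlo hhi
  exact abs_root_sub_root_le B hC hδ hδ' hlo hhi hκ hADt hroot hroot' hE₀ θ

/-- **Order 1, two frames**: with `W₀ = E₀/(Dt_min − 2A)`, `R₁ = (4+2A)π√2/(Dt_min − 2A)`, `‖D(−K′) − D(−K)‖ ≤ E₁`:
`|u_{K′}′ − u_K′| ≤ ((4+2A)W₀ + (π√2 + R₁)((4+4A)W₀ + E₁))/(Dt_min − 2A)`. [cite: BenfattoGiulianiMastropietro2006, §2.4 Lemma 2.1 (2.40)] -/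
theorem abs_deriv_frameRadius_sub_le {E₁ : ℝ}
    (hE₁ : ∀ k : Fin 2 → ℝ, (∀ i, |k i| ≤ π) →
      ‖fderiv ℝ (fun p : Fin 2 → ℝ => -K'.eval p) k - fderiv ℝ (fun p : Fin 2 → ℝ => -K.eval p) k‖ ≤ E₁) (θ : ℝ) :
    |deriv (perturbedFermiRadius (fun p : Fin 2 → ℝ => -K'.eval p) ν) θ - deriv (perturbedFermiRadius (fun p : Fin 2 → ℝ => -K.eval p) ν) θ| ≤
      ((4 + 2 * A) * (E₀ / (B.Dtmin - 2 * A)) +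
        (π * Real.sqrt 2 + (4 + 2 * A) * (π * Real.sqrt 2) / (B.Dtmin - 2 * A)) * ((4 + 4 * A) * (E₀ / (B.Dtmin - 2 * A)) + E₁)) /
        (B.Dtmin - 2 * A) := by
  obtain ⟨hC, hδ, hκ, hκ₂, hroot⟩ := frame_band_data B hA hlo hhi
  obtain ⟨hC', hδ', hκ', -, hroot'⟩ := frame_band_data B hA' hlo hhi
  exact abs_deriv_root_sub_le B hC hC' hδ hδ' hlo hhi hκ hκ' hADt hroot hroot' hE₀ hκ₂ hE₁ θ

/-- **Orders 2, 3, 4, two frames (incremental)**: with common order-3/4 sizes `A₃, A₄` (`‖D³ frameShift‖ ≤ A₃`, `‖D⁴ frameShift‖ ≤ A₄` for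
both frames — so `κ₃ = 8A₃`, `κ₄ = 16A₄`), difference sizes `E₁ … E₄`, tower bounds `R₁ … R₄` (both frames where needed) and lower
differences `W₁, W₂, W₃` at `θ`: the order-2, order-3 and order-4 differences of `…TwoFrameBand(34)` hold with `κ₁ = 2A`, `κ₂ = 4A`. -/
theorem abs_deriv_tower_frameRadius_sub_le {A₃ A₄ E₁ E₂ E₃ E₄ : ℝ}
    (hA₃ : ∀ p : Momentum, ‖iteratedFDeriv ℝ 3 (frameShift K) p‖ ≤ A₃) (hA₄ : ∀ p : Momentum, ‖iteratedFDeriv ℝ 4 (frameShift K) p‖ ≤ A₄)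
    (hE₁ : ∀ k : Fin 2 → ℝ, (∀ i, |k i| ≤ π) →
      ‖fderiv ℝ (fun p : Fin 2 → ℝ => -K'.eval p) k - fderiv ℝ (fun p : Fin 2 → ℝ => -K.eval p) k‖ ≤ E₁)
    (hE₂ : ∀ k : Fin 2 → ℝ, (∀ i, |k i| ≤ π) →
      ‖fderiv ℝ (fderiv ℝ (fun p : Fin 2 → ℝ => -K'.eval p)) k - fderiv ℝ (fderiv ℝ (fun p : Fin 2 → ℝ => -K.eval p)) k‖ ≤ E₂)
    (hE₃ : ∀ k : Fin 2 → ℝ, (∀ i, |k i| ≤ π) →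
      ‖fderiv ℝ (fderiv ℝ (fderiv ℝ (fun p : Fin 2 → ℝ => -K'.eval p))) k -
        fderiv ℝ (fderiv ℝ (fderiv ℝ (fun p : Fin 2 → ℝ => -K.eval p))) k‖ ≤ E₃)
    (hE₄ : ∀ k : Fin 2 → ℝ, (∀ i, |k i| ≤ π) →
      ‖fderiv ℝ (fderiv ℝ (fderiv ℝ (fderiv ℝ (fun p : Fin 2 → ℝ => -K'.eval p)))) k -
        fderiv ℝ (fderiv ℝ (fderiv ℝ (fderiv ℝ (fun p : Fin 2 → ℝ => -K.eval p)))) k‖ ≤ E₄)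
    {θ R₁ R₂ R₃ R₄ W₁ W₂ W₃ : ℝ}
    (hR₁ : |deriv (perturbedFermiRadius (fun p : Fin 2 → ℝ => -K.eval p) ν) θ| ≤ R₁)
    (hR₁' : |deriv (perturbedFermiRadius (fun p : Fin 2 → ℝ => -K'.eval p) ν) θ| ≤ R₁)
    (hR₂ : |deriv (deriv (perturbedFermiRadius (fun p : Fin 2 → ℝ => -K.eval p) ν)) θ| ≤ R₂)
    (hR₂' : |deriv (deriv (perturbedFermiRadius (fun p : Fin 2 → ℝ => -K'.eval p) ν)) θ| ≤ R₂)
    (hR₃ : |deriv (deriv (deriv (perturbedFermiRadius (fun p : Fin 2 → ℝ => -K.eval p) ν))) θ| ≤ R₃)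
    (hR₃' : |deriv (deriv (deriv (perturbedFermiRadius (fun p : Fin 2 → ℝ => -K'.eval p) ν))) θ| ≤ R₃)
    (hR₄ : |deriv (deriv (deriv (deriv (perturbedFermiRadius (fun p : Fin 2 → ℝ => -K.eval p) ν)))) θ| ≤ R₄)
    (hW₁ : |deriv (perturbedFermiRadius (fun p : Fin 2 → ℝ => -K'.eval p) ν) θ -
      deriv (perturbedFermiRadius (fun p : Fin 2 → ℝ => -K.eval p) ν) θ| ≤ W₁)
    (hW₂ : |deriv (deriv (perturbedFermiRadius (fun p : Fin 2 → ℝ => -K'.eval p) ν)) θ -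
      deriv (deriv (perturbedFermiRadius (fun p : Fin 2 → ℝ => -K.eval p) ν)) θ| ≤ W₂)
    (hW₃ : |deriv (deriv (deriv (perturbedFermiRadius (fun p : Fin 2 → ℝ => -K'.eval p) ν))) θ -
      deriv (deriv (deriv (perturbedFermiRadius (fun p : Fin 2 → ℝ => -K.eval p) ν))) θ| ≤ W₃) :
    (|deriv (deriv (perturbedFermiRadius (fun p : Fin 2 → ℝ => -K'.eval p) ν)) θ -
        deriv (deriv (perturbedFermiRadius (fun p : Fin 2 → ℝ => -K.eval p) ν)) θ| ≤
      E₀ / (B.Dtmin - 2 * A) +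
        (((4 + 8 * A₃) * (E₀ / (B.Dtmin - 2 * A)) + E₂) * (R₁ + π * Real.sqrt 2) ^ 2 +
          2 * (4 + 4 * A) * (R₁ + π * Real.sqrt 2) * (W₁ + E₀ / (B.Dtmin - 2 * A)) +
          ((4 + 4 * A) * (E₀ / (B.Dtmin - 2 * A)) + E₁) * (2 * R₁ + π * Real.sqrt 2) +
          (4 + 2 * A) * (E₀ / (B.Dtmin - 2 * A) + 2 * W₁) +
          (R₂ + π * Real.sqrt 2) * ((4 + 4 * A) * (E₀ / (B.Dtmin - 2 * A)) + E₁)) / (B.Dtmin - 2 * A)) ∧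
    (|deriv (deriv (deriv (perturbedFermiRadius (fun p : Fin 2 → ℝ => -K'.eval p) ν))) θ -
        deriv (deriv (deriv (perturbedFermiRadius (fun p : Fin 2 → ℝ => -K.eval p) ν))) θ| ≤
      (((4 + 16 * A₄) * (E₀ / (B.Dtmin - 2 * A)) + E₃) * (R₁ + π * Real.sqrt 2) ^ 3 +
        3 * (4 + 8 * A₃) * (W₁ + E₀ / (B.Dtmin - 2 * A)) * (R₁ + π * Real.sqrt 2) ^ 2 +
        3 * (((4 + 8 * A₃) * (E₀ / (B.Dtmin - 2 * A)) + E₂) * (R₁ + π * Real.sqrt 2) * (R₂ + 2 * R₁ + π * Real.sqrt 2) +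
          (4 + 4 * A) * ((W₂ + 2 * W₁ + E₀ / (B.Dtmin - 2 * A)) * (R₁ + π * Real.sqrt 2) +
            (R₂ + 2 * R₁ + π * Real.sqrt 2) * (W₁ + E₀ / (B.Dtmin - 2 * A)))) +
        ((4 + 4 * A) * (E₀ / (B.Dtmin - 2 * A)) + E₁) * (3 * R₂ + 3 * R₁ + π * Real.sqrt 2) +
        (4 + 2 * A) * (3 * W₂ + 3 * W₁ + E₀ / (B.Dtmin - 2 * A)) +
        R₃ * ((4 + 4 * A) * (E₀ / (B.Dtmin - 2 * A)) + E₁)) / (B.Dtmin - 2 * A)) ∧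
    (|deriv (deriv (deriv (deriv (perturbedFermiRadius (fun p : Fin 2 → ℝ => -K'.eval p) ν)))) θ -
        deriv (deriv (deriv (deriv (perturbedFermiRadius (fun p : Fin 2 → ℝ => -K.eval p) ν)))) θ| ≤
      ((4 * (E₀ / (B.Dtmin - 2 * A)) + 2 * (16 * A₄) + E₄) * (R₁ + π * Real.sqrt 2) ^ 4 +
        4 * (4 + 16 * A₄) * (W₁ + E₀ / (B.Dtmin - 2 * A)) * (R₁ + π * Real.sqrt 2) ^ 3 +
        6 * ((((4 + 16 * A₄) * (E₀ / (B.Dtmin - 2 * A)) + E₃) * (R₁ + π * Real.sqrt 2) ^ 2 * (R₂ + 2 * R₁ + π * Real.sqrt 2) +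
          (4 + 8 * A₃) * ((W₂ + 2 * W₁ + E₀ / (B.Dtmin - 2 * A)) * (R₁ + π * Real.sqrt 2) ^ 2 +
            2 * (R₁ + π * Real.sqrt 2) * (R₂ + 2 * R₁ + π * Real.sqrt 2) * (W₁ + E₀ / (B.Dtmin - 2 * A))))) +
        3 * ((((4 + 8 * A₃) * (E₀ / (B.Dtmin - 2 * A)) + E₂) * (R₂ + 2 * R₁ + π * Real.sqrt 2) ^ 2 +
          2 * (4 + 4 * A) * (R₂ + 2 * R₁ + π * Real.sqrt 2) * (W₂ + 2 * W₁ + E₀ / (B.Dtmin - 2 * A)))) +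
        4 * ((((4 + 8 * A₃) * (E₀ / (B.Dtmin - 2 * A)) + E₂) * (R₁ + π * Real.sqrt 2) * (R₃ + 3 * R₁ + 3 * R₂ + π * Real.sqrt 2) +
          (4 + 4 * A) * ((W₁ + E₀ / (B.Dtmin - 2 * A)) * (R₃ + 3 * R₁ + 3 * R₂ + π * Real.sqrt 2) +
            (R₁ + π * Real.sqrt 2) * (W₃ + 3 * W₁ + 3 * W₂ + E₀ / (B.Dtmin - 2 * A))))) +
        ((4 + 4 * A) * (E₀ / (B.Dtmin - 2 * A)) + E₁) * (6 * R₂ + 4 * R₃ + 4 * R₁ + π * Real.sqrt 2) +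
        (4 + 2 * A) * (6 * W₂ + 4 * W₃ + 4 * W₁ + E₀ / (B.Dtmin - 2 * A)) +
        R₄ * ((4 + 4 * A) * (E₀ / (B.Dtmin - 2 * A)) + E₁)) / (B.Dtmin - 2 * A)) := by
  obtain ⟨hC, hδ, hκ, hκ₂, hroot⟩ := frame_band_data B hA hlo hhi
  obtain ⟨hC', hδ', hκ', -, hroot'⟩ := frame_band_data B hA' hlo hhi
  have hκ₃ : ∀ k : Fin 2 → ℝ, (∀ i, |k i| ≤ π) → ‖fderiv ℝ (fderiv ℝ (fderiv ℝ (fun p : Fin 2 → ℝ => -K.eval p))) k‖ ≤ 8 * A₃ :=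
    fun k _ => norm_fderiv_three_frameShift_le hA₃ k
  have hκ₄ : ∀ k : Fin 2 → ℝ, (∀ i, |k i| ≤ π) →
      ‖fderiv ℝ (fderiv ℝ (fderiv ℝ (fderiv ℝ (fun p : Fin 2 → ℝ => -K.eval p)))) k‖ ≤ 16 * A₄ :=
    fun k _ => norm_fderiv_four_frameShift_le hA₄ k
  exact ⟨abs_deriv_two_root_sub_le B hC hC' hδ hδ' hlo hhi hκ hκ' hADt hroot hroot' hE₀ hκ₂ hκ₃ hE₁ hE₂ hR₁ hR₁' hR₂ hW₁,
    abs_deriv_three_root_sub_le B hC hC' hδ hδ' hlo hhi hκ hκ' hADt hroot hroot' hE₀ hκ₂ hκ₃ hκ₄ hE₁ hE₂ hE₃ hR₁ hR₁' hR₂ hR₂' hR₃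
      hW₁ hW₂,
    abs_deriv_four_root_sub_le B hC hC' hδ hδ' hlo hhi hκ hκ' hADt hroot hroot' hE₀ hκ₂ hκ₃ hκ₄ hE₁ hE₂ hE₃ hE₄ hR₁ hR₁' hR₂ hR₂'
      hR₃ hR₃' hR₄ hW₁ hW₂ hW₃⟩

omit hE₀ in
/-- **The curve towers of the two frames** (`γ_K θ = toLp 2 (klFermiPoint ν K θ)`): from the radius-tower differences `W₀ … W₄` at `θ`,
`‖Dⁱγ_{K′}(θ) − Dⁱγ_K(θ)‖ ≤ 2(W₀+W₁), 2(W₀+2W₁+W₂), 2(W₀+3W₁+3W₂+W₃), 2(W₀+4W₁+6W₂+4W₃+W₄)`. [folklore] -/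
theorem norm_iteratedFDeriv_fermiPointLp_sub_le_four_orders {θ W₀ W₁ W₂ W₃ W₄ : ℝ}
    (hW₀ : |perturbedFermiRadius (fun p : Fin 2 → ℝ => -K'.eval p) ν θ - perturbedFermiRadius (fun p : Fin 2 → ℝ => -K.eval p) ν θ| ≤ W₀)
    (hW₁ : |deriv (perturbedFermiRadius (fun p : Fin 2 → ℝ => -K'.eval p) ν) θ -
      deriv (perturbedFermiRadius (fun p : Fin 2 → ℝ => -K.eval p) ν) θ| ≤ W₁)
    (hW₂ : |deriv (deriv (perturbedFermiRadius (fun p : Fin 2 → ℝ => -K'.eval p) ν)) θ -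
      deriv (deriv (perturbedFermiRadius (fun p : Fin 2 → ℝ => -K.eval p) ν)) θ| ≤ W₂)
    (hW₃ : |deriv (deriv (deriv (perturbedFermiRadius (fun p : Fin 2 → ℝ => -K'.eval p) ν))) θ -
      deriv (deriv (deriv (perturbedFermiRadius (fun p : Fin 2 → ℝ => -K.eval p) ν))) θ| ≤ W₃)
    (hW₄ : |deriv (deriv (deriv (deriv (perturbedFermiRadius (fun p : Fin 2 → ℝ => -K'.eval p) ν)))) θ -
      deriv (deriv (deriv (deriv (perturbedFermiRadius (fun p : Fin 2 → ℝ => -K.eval p) ν)))) θ| ≤ W₄) :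
    ‖iteratedFDeriv ℝ 1 (fun θ : ℝ => (WithLp.toLp 2 (klFermiPoint ν K' θ) : Momentum)) θ -
        iteratedFDeriv ℝ 1 (fun θ : ℝ => (WithLp.toLp 2 (klFermiPoint ν K θ) : Momentum)) θ‖ ≤ 2 * (W₀ + W₁) ∧
    ‖iteratedFDeriv ℝ 2 (fun θ : ℝ => (WithLp.toLp 2 (klFermiPoint ν K' θ) : Momentum)) θ -
        iteratedFDeriv ℝ 2 (fun θ : ℝ => (WithLp.toLp 2 (klFermiPoint ν K θ) : Momentum)) θ‖ ≤ 2 * (W₀ + 2 * W₁ + W₂) ∧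
    ‖iteratedFDeriv ℝ 3 (fun θ : ℝ => (WithLp.toLp 2 (klFermiPoint ν K' θ) : Momentum)) θ -
        iteratedFDeriv ℝ 3 (fun θ : ℝ => (WithLp.toLp 2 (klFermiPoint ν K θ) : Momentum)) θ‖ ≤ 2 * (W₀ + 3 * W₁ + 3 * W₂ + W₃) ∧
    ‖iteratedFDeriv ℝ 4 (fun θ : ℝ => (WithLp.toLp 2 (klFermiPoint ν K' θ) : Momentum)) θ -
        iteratedFDeriv ℝ 4 (fun θ : ℝ => (WithLp.toLp 2 (klFermiPoint ν K θ) : Momentum)) θ‖ ≤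
      2 * (W₀ + 4 * W₁ + 6 * W₂ + 4 * W₃ + W₄) := by
  have hu : ContDiff ℝ 4 (perturbedFermiRadius (fun p : Fin 2 → ℝ => -K.eval p) ν) := contDiff_klFermiRadius B hA hADt hlo hhi
  have hv : ContDiff ℝ 4 (perturbedFermiRadius (fun p : Fin 2 → ℝ => -K'.eval p) ν) := contDiff_klFermiRadius B hA' hADt hlo hhi
  exact norm_iteratedFDeriv_curve_sub_le_four_orders hu hv hW₀ hW₁ hW₂ hW₃ hW₄

end TwoFrames

end Summit.HubbardSuperconductivity.HubbardSuperconductivity.Theorems.PerturbedFermiCurve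

end
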